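import Literature.Analysis.FluidPDE.OnsagerProofs
import Literature.Analysis.FluidPDE.PassiveScalarEnergyProofs
import Literature.Analysis.FunctionSpaces.TorusApproximateIdentity
import HarnessLib

/-!
# Existence of weak solutions of the passive scalar equation, I: smooth approximation of the data

Analysis/FluidPDE proof-support file, first of the two files discharging the named fact
`Literature.Analysis.FluidPDE.Torus.exists_isWeakScalarTransportOn` (`FluidPDE/PassiveScalar`:
for `κ > 0`, `θ₀ ∈ L²(T^d)` and a bounded, weakly divergence-free drift
`u ∈ L^∞((0,T) × T^d)` there is a weak solution of `∂ₜθ + u·∇θ = κΔθ` on `T^d × [0,T)` with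
datum `θ₀`, satisfying the energy inequality; DiPerna–Lions 1989, Prop. II.1 — existence of weak
solutions by regularisation of the coefficients and of the datum, the a priori `L^p` bound and
a weak limit — combined with the parabolic energy estimate, Evans 2010, §7.1.2, Thm. 2–3).

The discharge follows exactly that regularisation scheme. This file supplies the regularised
data:

* `Torus.exists_isSmooth_tendsto_eLpNorm_sub` — **the datum**: `θ₀ ∈ L²(T^d)` is the `L²` limit
  of smooth functions `gₙ = θ₀ ⋆ k_{εₙ}` with `‖gₙ‖_{L²} ≤ ‖θ₀‖_{L²}` (torus mollifier,
  `TorusConvolution`; Evans 2010, App. C.4, Thm. 7);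
* `Torus.ae_norm_le_prod_of_memLp_top_stLift` — the `L^∞` bound of the drift read on
  `(0,T) × T^d`;
* `Torus.tendsto_eLpNorm_vecMollify_uncurry_sub` — slice-wise spatial mollification of a
  square-integrable space–time vector field converges in `L²(ℝ × T^d)`;
* `Torus.exists_smooth_isDivFree_tendsto_eLpNorm_sub` — **the drift**: a bounded measurable
  `u : (0,T) × T^d → ℝ^d`, weakly divergence free at a.e. time, is the `L²((0,T) × T^d)` limit of
  fields `vₙ` whose space–time lifts are `C^∞` on all of `ℝ × ℝ^d` and all of whose time slices
  are (classically) divergence free: `vₙ = mollifiedField (φₙ) (εₙ) U` is the space–time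
  mollification (`TorusMollifiedFields`, the Constantin–E–Titi field of `OnsagerProofs`) of a
  strongly measurable representative `U` of `u 1_{(0,T)}`, with the time radius chosen along a
  diagonal (DiPerna–Lions 1989, proof of Prop. II.1: "we regularise `b`, `c` by convolution").

Everything is assembled from the tree (`OnsagerProofs`, `TorusApproximateIdentity`,
`TorusConvolution`, `PassiveScalarEnergyProofs`); no new definitions.

## References

* R. J. DiPerna, P.-L. Lions, *Ordinary differential equations, transport theory and Sobolev
  spaces*, Invent. Math. 98 (1989), 511–547, §II.1, Prop. II.1 and its proof. [DiPernaLions1989]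
* L. C. Evans, *Partial Differential Equations*, 2nd ed. (AMS 2010), §7.1.2 (Thm. 2–3) and
  App. C.4, Thm. 7. [Evans2010]
-/

noncomputable section

open MeasureTheory TopologicalSpace Set Function Filter Metric
open _root_.Topology
open scoped ENNReal NNReal Convolution InnerProductSpace ContDiff

namespace Literature.Analysis.FluidPDE

namespace Torus

variable {d : Type*} [Fintype d]

/-! ## The datum: smooth `L²` approximation on the torus -/

section Datum

/-- **Smooth approximation of an `L²` datum on `T^d`**: for `θ₀ ∈ L²(T^d)` there are smooth
`gₙ` with `‖gₙ‖_{L²} ≤ ‖θ₀‖_{L²}` and `‖gₙ - θ₀‖_{L²} → 0` (mollification by the torus kernel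
`k_{εₙ}`, `εₙ = 1/(4(n+1))`: smoothness, Young's inequality with a unit-mass kernel, and the `L²`
approximate identity; Evans 2010, App. C.4, Thm. 7 (i), (iv); the regularised datum `u⁰_ε` of
DiPerna–Lions 1989, proof of Prop. II.1). [cite: Evans2010, App. C.4 Thm. 7] -/
theorem exists_isSmooth_tendsto_eLpNorm_sub {θ₀ : UnitAddTorus d → ℝ} (hθ₀ : MemLp θ₀ 2 volume) :
    ∃ g : ℕ → UnitAddTorus d → ℝ, (∀ n, FunctionSpaces.Torus.IsSmooth (g n)) ∧
      (∀ n, eLpNorm (g n) 2 volume ≤ eLpNorm θ₀ 2 volume) ∧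
      Tendsto (fun n => eLpNorm (g n - θ₀) 2 volume) atTop (𝓝 0) := by
  obtain ⟨hpos, hle, hlim⟩ := molRadius_spec
  have hθi : Integrable θ₀ volume := hθ₀.integrable one_le_two
  refine ⟨fun n => θ₀ ⋆ FunctionSpaces.Torus.kernel (1 / (4 * ((n : ℝ) + 1))), fun n => ?_, fun n => ?_, ?_⟩
  · exact FunctionSpaces.Torus.isSmooth_convolution hθi (FunctionSpaces.Torus.isSmooth_kernel (hpos n) (hle n))
  · have h := FunctionSpaces.Torus.eLpNorm_convolution_le hθ₀.1
      (FunctionSpaces.Torus.continuous_kernel (hpos n) (hle n)).aestronglyMeasurable one_le_two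
    rwa [FunctionSpaces.Torus.lintegral_enorm_kernel (hpos n) (hle n), one_mul] at h
  · exact FunctionSpaces.Torus.tendsto_eLpNorm_convolution_sub_self hθ₀
      (fun n y => FunctionSpaces.Torus.kernel_nonneg (hpos n).le y)
      (fun n => FunctionSpaces.Torus.integral_kernel (hpos n) (hle n))
      (fun n => FunctionSpaces.Torus.support_kernel_subset (hpos n))
      (fun n => FunctionSpaces.Torus.continuous_kernel (hpos n) (hle n)) hlim

end Datum

/-! ## The drift: bounds on `(0,T) × T^d` -/

section DriftBounds

/-- **The `L^∞` bound of the drift on `(0,T) × T^d`**: from `u ∈ L^∞((0,T) × ℝ^d)` (space–time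
lift) there is `C ≥ 0` with `‖u(t, x)‖ ≤ C` for a.e. `(t, x) ∈ (0,T) × T^d` (the essential
supremum transported along the quasi-measure-preserving `id × repr`; product-measure form of the
tree's `Torus.ae_ae_norm_le_of_memLp_top_stLift`). [folklore] -/
theorem ae_norm_le_prod_of_memLp_top_stLift {u : ℝ → UnitAddTorus d → EuclideanSpace ℝ d} {T : ℝ}
    (hu : MemLp (FunctionSpaces.Torus.stLift u) ∞ (volume.restrict (Ioo 0 T ×ˢ univ))) :
    ∃ C : ℝ, 0 ≤ C ∧ ∀ᵐ q ∂(((volume : Measure ℝ).restrict (Ioo 0 T)).prod (volume : Measure (UnitAddTorus d))),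
      ‖u q.1 q.2‖ ≤ C := by
  set μ' : Measure (ℝ × EuclideanSpace ℝ d) := volume.restrict (Ioo 0 T ×ˢ univ) with hμ'
  set C : ℝ := (eLpNorm (FunctionSpaces.Torus.stLift u) ∞ μ').toReal with hC
  have hfin : eLpNorm (FunctionSpaces.Torus.stLift u) ∞ μ' < (⊤ : ℝ≥0∞) := hu.eLpNorm_lt_top
  have hae' : ∀ᵐ p ∂μ', ‖FunctionSpaces.Torus.stLift u p‖ ≤ C := by
    filter_upwards [ae_le_eLpNormEssSup (f := FunctionSpaces.Torus.stLift u) (μ := μ')] with p hp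
    rw [← eLpNorm_exponent_top] at hp
    have := ENNReal.toReal_mono hfin.ne hp
    rwa [toReal_enorm] at this
  refine ⟨C, ENNReal.toReal_nonneg, ?_⟩
  have hprod : μ' = ((volume : Measure ℝ).restrict (Ioo 0 T)).prod volume := by
    rw [hμ', Measure.volume_eq_prod, ← Measure.prod_restrict, Measure.restrict_univ]
  rw [hprod] at hae'
  have hq := MeasureTheory.QuasiMeasurePreserving.prodMap
    (Measure.QuasiMeasurePreserving.id ((volume : Measure ℝ).restrict (Ioo 0 T)))
    (FunctionSpaces.Torus.quasiMeasurePreserving_repr (d := d))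
  filter_upwards [hq.ae hae'] with q hq'
  simpa [FunctionSpaces.Torus.stLift] using hq'

/-- `∫⁻₍₀,T₎ ∫⁻ ‖u‖² < ∞` for an essentially bounded drift. [folklore] -/
theorem lintegral_lintegral_sq_lt_top_of_memLp_top_stLift {u : ℝ → UnitAddTorus d → EuclideanSpace ℝ d}
    {T : ℝ} (hu : MemLp (FunctionSpaces.Torus.stLift u) ∞ (volume.restrict (Ioo 0 T ×ˢ univ))) :
    ∫⁻ t in Ioo 0 T, ∫⁻ x, ‖u t x‖ₑ ^ 2 < ⊤ := by
  obtain ⟨C, -, hCae⟩ := ae_ae_norm_le_of_memLp_top_stLift hu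
  calc ∫⁻ t in Ioo 0 T, ∫⁻ x, ‖u t x‖ₑ ^ 2 ≤ ∫⁻ _ in Ioo 0 T, ENNReal.ofReal C ^ 2 := by
        refine lintegral_mono_ae ?_
        filter_upwards [hCae] with t ht
        calc ∫⁻ x, ‖u t x‖ₑ ^ 2 ≤ ∫⁻ _ : UnitAddTorus d, ENNReal.ofReal C ^ 2 := by
              refine lintegral_mono_ae ?_
              filter_upwards [ht] with x hx
              gcongr
              rw [← ofReal_norm]
              exact ENNReal.ofReal_le_ofReal hx
          _ = ENNReal.ofReal C ^ 2 := by rw [lintegral_const, measure_univ, mul_one]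
    _ < ⊤ := by
        rw [lintegral_const, Measure.restrict_apply_univ]
        exact ENNReal.mul_lt_top (ENNReal.pow_lt_top ENNReal.ofReal_lt_top) measure_Ioo_lt_top

end DriftBounds

/-! ## Slice-wise spatial mollification of space–time vector fields converges in `L²` -/

section SpaceLimit

variable [DecidableEq d] {U : ℝ → UnitAddTorus d → EuclideanSpace ℝ d}

/-- **`u^{εₘ} → U` in `L²(ℝ × T^d)`** for a strongly measurable `U ∈ L²(ℝ × T^d; ℝ^d)` and radii
`εₘ = 1/(4(m+1))`, `u^ε(s) = vecMollify ε (U s)` (coordinatewise: the tree's space–time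
approximate identity `Torus.tendsto_lintegral_prod_rpow_enorm_convolution_sub_self`, Evans 2010,
App. C.4, Thm. 7 (iv) integrated in time; the vector difference is dominated by the sum of its
coordinates). [folklore] -/
theorem tendsto_eLpNorm_vecMollify_uncurry_sub (hUm : StronglyMeasurable (uncurry U))
    (hU2 : MemLp (uncurry U) 2 ((volume : Measure ℝ).prod volume)) :
    Tendsto (fun m : ℕ => eLpNorm (fun q : ℝ × UnitAddTorus d =>
      FunctionSpaces.Torus.vecMollify (1 / (4 * ((m : ℝ) + 1))) (U q.1) q.2 - U q.1 q.2) 2 (volume.prod volume))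
      atTop (𝓝 0) := by
  obtain ⟨hpos, hle, hlim⟩ := molRadius_spec
  set ε : ℕ → ℝ := fun m => 1 / (4 * ((m : ℝ) + 1)) with hε
  have hk : ∀ m, Continuous (FunctionSpaces.Torus.kernel (d := d) (ε m)) := fun m =>
    FunctionSpaces.Torus.continuous_kernel (hpos m) (hle m)
  -- coordinatewise convergence of `∫∫ |Uᵢ ⋆ k_ε - Uᵢ|²`
  have hcoord : ∀ i, Tendsto (fun m => ∫⁻ z, ‖((fun y => U z.1 y i) ⋆ FunctionSpaces.Torus.kernel (ε m)) z.2 - U z.1 z.2 i‖ₑ ^ (2 : ℝ)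
      ∂((volume : Measure ℝ).prod volume)) atTop (𝓝 0) := by
    intro i
    have hm : AEStronglyMeasurable (uncurry fun s y => U s y i) ((volume : Measure ℝ).prod volume) :=
      (stronglyMeasurable_uncurry_apply hUm i).aestronglyMeasurable
    have hfin : ∫⁻ z, ‖(fun s y => U s y i) z.1 z.2‖ₑ ^ (2 : ℝ) ∂((volume : Measure ℝ).prod volume) < ⊤ := by
      have h2 := lintegral_rpow_enorm_lt_top_of_eLpNorm_lt_top two_ne_zero ENNReal.ofNat_ne_top hU2.2
      simp only [ENNReal.toReal_ofNat] at h2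
      refine lt_of_le_of_lt (lintegral_mono fun z => ?_) h2
      gcongr
      simpa [uncurry, Real.enorm_eq_ofReal_abs, ← ofReal_norm] using
        ENNReal.ofReal_le_ofReal (PiLp.norm_apply_le (U z.1 z.2) i)
    refine FunctionSpaces.Torus.tendsto_lintegral_prod_rpow_enorm_convolution_sub_self
      (Eventually.of_forall fun m => ⟨fun y => FunctionSpaces.Torus.kernel_nonneg (hpos m).le y,
        FunctionSpaces.Torus.integral_kernel (hpos m) (hle m), hk m⟩) (fun δ hδ => ?_) hm one_le_two hfin
    filter_upwards [(tendsto_order.1 hlim).2 δ hδ] with m hm'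
    exact (FunctionSpaces.Torus.support_kernel_subset (hpos m)).trans (ball_subset_ball hm'.le)
  -- in `eLpNorm` form
  have hcoord' : ∀ i, Tendsto (fun m => eLpNorm (fun z : ℝ × UnitAddTorus d =>
      ((fun y => U z.1 y i) ⋆ FunctionSpaces.Torus.kernel (ε m)) z.2 - U z.1 z.2 i) 2 ((volume : Measure ℝ).prod volume))
      atTop (𝓝 0) := by
    intro i
    have h := ((ENNReal.continuous_rpow_const (y := 1 / (2 : ℝ))).tendsto 0).comp (hcoord i)
    rw [ENNReal.zero_rpow_of_pos (by norm_num)] at h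
    refine h.congr fun m => ?_
    rw [Function.comp_apply, eLpNorm_eq_lintegral_rpow_enorm_toReal two_ne_zero ENNReal.ofNat_ne_top,
      ENNReal.toReal_ofNat]
  -- domination of the vector difference by the sum of its coordinates
  have hci : ∀ m i, StronglyMeasurable (uncurry fun s x => ((fun y => U s y i) ⋆ FunctionSpaces.Torus.kernel (ε m)) x) :=
    fun m i => stronglyMeasurable_uncurry_convolution (stronglyMeasurable_uncurry_apply hUm i) (hk m)
  have hbound : ∀ m, eLpNorm (fun q : ℝ × UnitAddTorus d =>
      FunctionSpaces.Torus.vecMollify (ε m) (U q.1) q.2 - U q.1 q.2) 2 (volume.prod volume) ≤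
      ∑ i, eLpNorm (fun z : ℝ × UnitAddTorus d =>
        ((fun y => U z.1 y i) ⋆ FunctionSpaces.Torus.kernel (ε m)) z.2 - U z.1 z.2 i) 2 ((volume : Measure ℝ).prod volume) := by
    intro m
    have hmeas : ∀ i ∈ Finset.univ, AEStronglyMeasurable (fun z : ℝ × UnitAddTorus d =>
        ‖((fun y => U z.1 y i) ⋆ FunctionSpaces.Torus.kernel (ε m)) z.2 - U z.1 z.2 i‖) ((volume : Measure ℝ).prod volume) :=
      fun i _ => (((hci m i).sub (stronglyMeasurable_uncurry_apply hUm i)).norm).aestronglyMeasurable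
    calc eLpNorm (fun q : ℝ × UnitAddTorus d =>
          FunctionSpaces.Torus.vecMollify (ε m) (U q.1) q.2 - U q.1 q.2) 2 (volume.prod volume)
        ≤ eLpNorm (∑ i, fun z : ℝ × UnitAddTorus d =>
            ‖((fun y => U z.1 y i) ⋆ FunctionSpaces.Torus.kernel (ε m)) z.2 - U z.1 z.2 i‖) 2 ((volume : Measure ℝ).prod volume) := by
          refine eLpNorm_mono fun q => ?_
          rw [Finset.sum_apply, Real.norm_of_nonneg (Finset.sum_nonneg fun i _ => norm_nonneg _)]
          refine (norm_le_sum_norm_apply _).trans (le_of_eq (Finset.sum_congr rfl fun i _ => ?_))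
          rw [PiLp.sub_apply, FunctionSpaces.Torus.vecMollify_apply]
      _ ≤ ∑ i, eLpNorm (fun z : ℝ × UnitAddTorus d =>
            ‖((fun y => U z.1 y i) ⋆ FunctionSpaces.Torus.kernel (ε m)) z.2 - U z.1 z.2 i‖) 2 ((volume : Measure ℝ).prod volume) :=
          eLpNorm_sum_le hmeas one_le_two
      _ = _ := Finset.sum_congr rfl fun i _ => eLpNorm_norm _
  have hsum : Tendsto (fun m => ∑ i, eLpNorm (fun z : ℝ × UnitAddTorus d =>
      ((fun y => U z.1 y i) ⋆ FunctionSpaces.Torus.kernel (ε m)) z.2 - U z.1 z.2 i) 2 ((volume : Measure ℝ).prod volume))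
      atTop (𝓝 0) := by
    have h := tendsto_finsetSum (Finset.univ : Finset d) fun i _ => hcoord' i
    simpa using h
  exact tendsto_of_tendsto_of_tendsto_of_le_of_le tendsto_const_nhds hsum (fun m => zero_le) hbound

end SpaceLimit

/-! ## The drift: smooth divergence-free approximation in `L²((0,T) × T^d)` -/

section Drift

variable [DecidableEq d]

/-- **Smooth divergence-free approximation of a bounded, weakly divergence-free drift**
(the regularised coefficients `b_ε = b ⋆ ρ_ε` of DiPerna–Lions 1989, proof of Prop. II.1, here
mollified in space and time): let `u : (0,T) × T^d → ℝ^d` be essentially bounded (space–time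
lift in `L^∞`) and weakly divergence free at a.e. time. Then there are fields `vₙ : ℝ × T^d → ℝ^d`
whose space–time lifts are `C^∞` on all of `ℝ × ℝ^d`, all of whose time slices are divergence
free, and which converge to `u` in `L²((0,T) × T^d)`. Construction: `vₙ` is the space–time
mollification `mollifiedField (φ_{N(n)}) (εₙ) U` of a strongly measurable representative `U` of
`u 1_{(0,T)}` (`OnsagerProofs`), with the time radius `N(n)` chosen so that
`‖vₙ - u^{εₙ}‖_{L²} ≤ εₙ` (diagonal) and `u^{εₙ} → U` in `L²`
(`tendsto_eLpNorm_vecMollify_uncurry_sub`). [cite: DiPernaLions1989, Prop. II.1, proof] -/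
theorem exists_smooth_isDivFree_tendsto_eLpNorm_sub {T : ℝ} {u : ℝ → UnitAddTorus d → EuclideanSpace ℝ d}
    (hu : MemLp (FunctionSpaces.Torus.stLift u) ∞ (volume.restrict (Ioo 0 T ×ˢ univ)))
    (hdiv : ∀ᵐ t ∂(volume.restrict (Ioo 0 T)), FunctionSpaces.Torus.IsWeaklyDivFree (u t)) :
    ∃ v : ℕ → ℝ → UnitAddTorus d → EuclideanSpace ℝ d,
      (∀ n, ContDiff ℝ ∞ (FunctionSpaces.Torus.stLift (v n))) ∧
      (∀ n t, FunctionSpaces.Torus.IsDivFree (v n t)) ∧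
      Tendsto (fun n => eLpNorm (fun q : ℝ × UnitAddTorus d => v n q.1 q.2 - u q.1 q.2) 2
        (((volume : Measure ℝ).restrict (Ioo 0 T)).prod volume)) atTop (𝓝 0) := by
  -- a strongly measurable representative of `u 1_{(0,T)}`
  have hum : AEStronglyMeasurable (uncurry u) (volume.restrict (Ioo 0 T ×ˢ (univ : Set (UnitAddTorus d)))) :=
    FunctionSpaces.Torus.aestronglyMeasurable_uncurry_of_stLift_restrict hu.1
  obtain ⟨U, hUm, hU0, hUae, hUu⟩ := exists_stronglyMeasurable_representative hum
  have hU2 : MemLp (uncurry U) 2 ((volume : Measure ℝ).prod volume) :=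
    memLp_two_representative hUm hU0 hUu (lintegral_lintegral_sq_lt_top_of_memLp_top_stLift hu)
  have hUi : Integrable (uncurry U) ((volume : Measure ℝ).prod volume) := integrable_representative hU0 hU2
  have hUdiv : ∀ᵐ s ∂(volume : Measure ℝ), FunctionSpaces.Torus.IsWeaklyDivFree (U s) :=
    ae_isWeaklyDivFree_representative hU0 hUu hdiv
  -- parameters: time bumps of radius `→ 0`, space radii `εₘ = 1/(4(m+1))`
  obtain ⟨φ, -, hφ⟩ := exists_contDiffBump_seq_rOut one_pos
  obtain ⟨hpos, hle, hlim⟩ := molRadius_spec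
  set ε : ℕ → ℝ := fun m => 1 / (4 * ((m : ℝ) + 1)) with hε
  -- diagonal choice of the time radius
  have hA : ∀ m, ∃ N : ℕ, eLpNorm (fun q : ℝ × UnitAddTorus d =>
      FunctionSpaces.Torus.mollifiedField (φ N) (ε m) U q.1 q.2 - FunctionSpaces.Torus.vecMollify (ε m) (U q.1) q.2) 2
        ((volume : Measure ℝ).prod volume) ≤ ENNReal.ofReal (ε m) := by
    intro m
    have h := tendsto_eLpNorm_mollifiedField_sub hUm hUi hU2 (hpos m) (hle m) hφ
    obtain ⟨N, hN⟩ := (ENNReal.tendsto_atTop_zero.1 h) (ENNReal.ofReal (ε m)) (ENNReal.ofReal_pos.2 (hpos m))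
    exact ⟨N, hN N le_rfl⟩
  choose N hN using hA
  have hAlim : Tendsto (fun m => eLpNorm (fun q : ℝ × UnitAddTorus d =>
      FunctionSpaces.Torus.mollifiedField (φ (N m)) (ε m) U q.1 q.2 - FunctionSpaces.Torus.vecMollify (ε m) (U q.1) q.2) 2
        ((volume : Measure ℝ).prod volume)) atTop (𝓝 0) := by
    have h0 : Tendsto (fun m => ENNReal.ofReal (ε m)) atTop (𝓝 0) := by
      rw [← ENNReal.ofReal_zero]
      exact ENNReal.tendsto_ofReal hlim
    exact tendsto_of_tendsto_of_tendsto_of_le_of_le tendsto_const_nhds h0 (fun m => zero_le) hN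
  have hBlim := tendsto_eLpNorm_vecMollify_uncurry_sub hUm hU2
  -- the approximating fields
  set v : ℕ → ℝ → UnitAddTorus d → EuclideanSpace ℝ d := fun m => FunctionSpaces.Torus.mollifiedField (φ (N m)) (ε m) U
    with hv
  refine ⟨v, fun m => contDiff_stLift_mollifiedField hUi (hpos m) (hle m),
    fun m t => isDivFree_mollifiedField hUi hUdiv (hpos m) (hle m) t, ?_⟩
  -- measurability of the pieces
  have hvm : ∀ m, StronglyMeasurable (uncurry (v m)) := fun m =>
    (continuous_uncurry_mollifiedField hUi (hpos m) (hle m)).stronglyMeasurable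
  have hwm : ∀ m, AEStronglyMeasurable (fun q : ℝ × UnitAddTorus d => FunctionSpaces.Torus.vecMollify (ε m) (U q.1) q.2)
      ((volume : Measure ℝ).prod volume) := by
    intro m
    have h : ∀ i, StronglyMeasurable (uncurry fun s x => ((fun y => U s y i) ⋆ FunctionSpaces.Torus.kernel (ε m)) x) :=
      fun i => stronglyMeasurable_uncurry_convolution (stronglyMeasurable_uncurry_apply hUm i)
        (FunctionSpaces.Torus.continuous_kernel (hpos m) (hle m))
    have h' : (fun q : ℝ × UnitAddTorus d => FunctionSpaces.Torus.vecMollify (ε m) (U q.1) q.2) =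
        fun q => WithLp.toLp 2 fun i => (uncurry fun s x => ((fun y => U s y i) ⋆ FunctionSpaces.Torus.kernel (ε m)) x) q := by
      funext q; rfl
    rw [h']
    exact ((PiLp.continuous_toLp 2 _).measurable.comp
      (measurable_pi_iff.2 fun i => (h i).measurable)).aestronglyMeasurable
  -- `‖v m - u‖_{L²((0,T)×T^d)} = ‖v m - U‖_{L²((0,T)×T^d)} ≤ ‖v m - U‖_{L²(ℝ×T^d)} ≤ ‖v m - u^ε‖ + ‖u^ε - U‖`
  have hμle : ((volume : Measure ℝ).restrict (Ioo 0 T)).prod (volume : Measure (UnitAddTorus d)) ≤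
      (volume : Measure ℝ).prod volume := by
    rw [← Measure.restrict_univ (μ := (volume : Measure (UnitAddTorus d))), Measure.prod_restrict,
      Measure.restrict_univ]
    exact Measure.restrict_le_self
  have hUu' : (fun q : ℝ × UnitAddTorus d => U q.1 q.2) =ᵐ[((volume : Measure ℝ).restrict (Ioo 0 T)).prod volume]
      fun q => u q.1 q.2 := by
    have h1 : uncurry U =ᵐ[volume.restrict (Ioo 0 T ×ˢ (univ : Set (UnitAddTorus d)))]
        (Ioo 0 T ×ˢ univ).indicator (uncurry u) := ae_restrict_of_ae hUae
    have h2 : (Ioo 0 T ×ˢ (univ : Set (UnitAddTorus d))).indicator (uncurry u)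
        =ᵐ[volume.restrict (Ioo 0 T ×ˢ (univ : Set (UnitAddTorus d)))] uncurry u :=
      indicator_ae_eq_restrict (measurableSet_Ioo.prod MeasurableSet.univ)
    have h3 := h1.trans h2
    rw [volume_restrict_prod_eq] at h3
    exact h3
  have hkey : ∀ m, eLpNorm (fun q : ℝ × UnitAddTorus d => v m q.1 q.2 - u q.1 q.2) 2
      (((volume : Measure ℝ).restrict (Ioo 0 T)).prod volume) ≤
      eLpNorm (fun q : ℝ × UnitAddTorus d =>
        FunctionSpaces.Torus.mollifiedField (φ (N m)) (ε m) U q.1 q.2 - FunctionSpaces.Torus.vecMollify (ε m) (U q.1) q.2) 2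
        ((volume : Measure ℝ).prod volume) +
      eLpNorm (fun q : ℝ × UnitAddTorus d =>
        FunctionSpaces.Torus.vecMollify (ε m) (U q.1) q.2 - U q.1 q.2) 2 ((volume : Measure ℝ).prod volume) := by
    intro m
    calc eLpNorm (fun q : ℝ × UnitAddTorus d => v m q.1 q.2 - u q.1 q.2) 2
          (((volume : Measure ℝ).restrict (Ioo 0 T)).prod volume)
        = eLpNorm (fun q : ℝ × UnitAddTorus d => v m q.1 q.2 - U q.1 q.2) 2
          (((volume : Measure ℝ).restrict (Ioo 0 T)).prod volume) := by
          refine eLpNorm_congr_ae ?_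
          filter_upwards [hUu'] with q hq
          rw [hq]
      _ ≤ eLpNorm (fun q : ℝ × UnitAddTorus d => v m q.1 q.2 - U q.1 q.2) 2 ((volume : Measure ℝ).prod volume) :=
          eLpNorm_mono_measure _ hμle
      _ = eLpNorm ((fun q : ℝ × UnitAddTorus d =>
            FunctionSpaces.Torus.mollifiedField (φ (N m)) (ε m) U q.1 q.2 - FunctionSpaces.Torus.vecMollify (ε m) (U q.1) q.2) +
            fun q : ℝ × UnitAddTorus d => FunctionSpaces.Torus.vecMollify (ε m) (U q.1) q.2 - U q.1 q.2) 2
          ((volume : Measure ℝ).prod volume) := by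
          congr 1
          funext q
          simp only [Pi.add_apply, hv, sub_add_sub_cancel]
      _ ≤ _ := eLpNorm_add_le (((hvm m).aestronglyMeasurable.sub (hwm m))) ((hwm m).sub hUm.aestronglyMeasurable) one_le_two
  have hsum : Tendsto (fun m => eLpNorm (fun q : ℝ × UnitAddTorus d =>
        FunctionSpaces.Torus.mollifiedField (φ (N m)) (ε m) U q.1 q.2 - FunctionSpaces.Torus.vecMollify (ε m) (U q.1) q.2) 2
        ((volume : Measure ℝ).prod volume) +
      eLpNorm (fun q : ℝ × UnitAddTorus d =>
        FunctionSpaces.Torus.vecMollify (ε m) (U q.1) q.2 - U q.1 q.2) 2 ((volume : Measure ℝ).prod volume)) atTop (𝓝 0) := by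
    have h := hAlim.add hBlim
    rwa [add_zero] at h
  exact tendsto_of_tendsto_of_tendsto_of_le_of_le tendsto_const_nhds hsum (fun m => zero_le) hkey

end Drift

end Torus

end Literature.Analysis.FluidPDE

end
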